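import Summits.FinalStateConjecture.FinalStateConjecture.Theorems.ZeroEnergyKerrOrBombStationaryLimitReductionStubChartTransfer
import HarnessLib

/-!
# Route ZeroEnergyKerrOrBomb · crux `StationaryLimitReduction` (stmt-FinalStateConjecture-10021), line
# `symplectic-dual-of-the-bomb` — the chart transfer in GENERAL POSITION (reshape r4: stub 1F discharged)

Wave 2 closed the registered stub `stub_chartTransfer : Sig.stub_chartTransfer` (r3 text, p120456,
`…StubChartTransfer.lean`). Its proof uses, of the r3 hypotheses, only the exterior equation in the form
`O ⊆ exteriorOf 𝒟 U` for some `U`, the Kerr identifications `IsKerrChartedWith` and the covering clauses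
`KerrSchildRecutCovering`; the r3 currency clauses `O = exteriorOf 𝒟 (docCharted d)`, `HasExhaustiveDocCharts d`,
`IsHorizonNormalised d` and hole regularity are idle there — and the first two were shown by the wave-2 audit
of `stub_recutCovering` to have NO honest model once `N ≥ 1` (the structure field `IsLateChart.image_subset`
forces the late collar images into `O`; `reach_of_hasExhaustiveDocCharts`, p116597). This file records the
chart transfer with exactly the hypotheses it needs, on the honest exterior equation
`O = exteriorOf 𝒟 d.charted` of the r1/r4 currency:

* `stub_chartTransferGeneral` — `O = exteriorOf 𝒟 d.charted` + `∀ i, IsKerrChartedWith …` +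
  `KerrSchildRecutCovering 𝒟 d M a Θ` ⇒ the summit's Kerr–Schild `FinalStateDecomposition` triple.

The proof is that of `stub_chartTransfer` VERBATIM (same recut decomposition at a late time `τ₁`), so reshape r4
of the skeleton drops stub 1F and feeds stub 1G's conclusion directly into this theorem. No named fact,
nothing restated. References: Dafermos–Luk arXiv:1710.01722, §1.2.1, Conjecture 1.

RE-TYPE REPAIR (lead c5, 2026-08-16T23:3xZ; statement byte-identical, proof only): since the summit re-type
of 21:18Z (p126844) `Summit.FinalStateConjecture.HasExhaustiveCharts` carries the honest-radii clause
`∀ i, Tendsto (R i) atTop atTop ∧ ∀ τ, max (r₊(Mᵢ, aᵢ), 0) + 1 ≤ R i τ`. The covering clauses already give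
growing radii `R'ᵢ → ∞`; the proof now uses `R''ᵢ τ := max (R'ᵢ τ) (max (r₊, 0) + 1)`, which eventually
equals `R'ᵢ τ` (so the near-zone convergence is unchanged) and only enlarges the certified late regions and
slabs (so clause (ii) is inherited by monotonicity of `J⁻`).
-/

-- every `Summit.FinalStateConjecture.FinalStateConjecture.…` name repeats the summit = sub-problem segment (D-0017 layout)
set_option linter.dupNamespace false

noncomputable section

open scoped Topology ENNReal Manifold ContDiff
open Set Filter Function

namespace Summit.FinalStateConjecture.FinalStateConjecture.Theorems.SymplecticDualOfTheBomb

open Literature.Geometry.Lorentzian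

/-- **The chart transfer in general position** (r4): for ANY `C²` stationary final-state decomposition `d`
of `O = exteriorOf 𝒟 d.charted`, Kerr identifications of its holes with asymptotic control
(`IsKerrChartedWith`) and the causal covering clauses of the naive Kerr–Schild recut
(`KerrSchildRecutCovering`), the summit's Kerr–Schild `FinalStateDecomposition d'` of
`O' = exteriorOf 𝒟 d'.charted`, sub-extremal, with exhaustive charts. Proof verbatim that of the closed
stub `stub_chartTransfer` (p120456), whose three further hypotheses were idle. [cite: DafermosLuk2017, Conjecture 1] -/
theorem stub_chartTransferGeneral : ∀ (X : Type) [TopologicalSpace X] [ChartedSpace E3 X] [IsManifold (𝓡 3) ∞ X] [T2Space X] [SecondCountableTopology X] [ConnectedSpace X] (D : InitialDataSet (𝓡 3) X) (𝒟 : VacuumCauchyDevelopment D) (O : Set 𝒟.carrier) (d : StationaryFinalStateDecomposition 𝒟.toSpacetime O 2) (M a c r₀ : Fin d.N → ℝ) (Θ : Fin d.N → E4 → E4), O = Summit.FinalStateConjecture.exteriorOf 𝒟.toCauchyDevelopment d.charted → (∀ i, IsKerrChartedWith (d.hole i) (d.adapted i) (M i) (a i) (c i) (r₀ i) (Θ i))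 → KerrSchildRecutCovering 𝒟 d M a Θ → ∃ (O' : Set 𝒟.carrier) (d' : FinalStateDecomposition 𝒟.toSpacetime O' 2), (∀ i, Kerr.IsSubextremal (d'.mass i) (d'.spin i)) ∧ O' = Summit.FinalStateConjecture.exteriorOf 𝒟.toCauchyDevelopment d'.charted ∧ Summit.FinalStateConjecture.HasExhaustiveCharts d' := by
  intro X _ _ _ _ _ _ D 𝒟 O d M a c r₀ Θ hO hK hG
  -- the clauses of `IsKerrChartedWith`
  have hsub := fun i ↦ (hK i).1
  have hc := fun i ↦ (hK i).2.1
  have hr₀ := fun i ↦ (hK i).2.2.2.1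
  have hΘs := fun i ↦ (hK i).2.2.2.2.1
  have hinj := fun i ↦ (hK i).2.2.2.2.2.1
  have hΘm := fun i ↦ (hK i).2.2.2.2.2.2.1
  have hΘe := fun i ↦ (hK i).2.2.2.2.2.2.2.1
  have hiso := fun i ↦ (hK i).2.2.2.2.2.2.2.2.1
  have hsubreg : ∀ i, (Kerr.exterior (M i) (a i) : Set E4) ⊆ (Kerr.region (a i) (r₀ i) : Set E4) :=
    fun i z hz ↦ Kerr.mem_region.2 ((max_le_max (hr₀ i).le le_rfl).trans_lt (Kerr.mem_exterior.1 hz))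
  -- the recut maps carry the boosted exteriors into the moved adapted domains
  have hmaps : ∀ i, MapsTo (recutMap (d.motion i).1 (d.motion i).2 (Θ i))
      ((recutBackground d M a i).domain : Set E4) ((d.background i).domain : Set E4) := fun i x hx ↦
    mapsTo_conj (d.motion i).1 (d.motion i).2 (hΘm i) (hsubreg i (mem_boostedKerrExterior.1 hx))
  obtain ⟨τ₀', R', hτ₀', hR', hconv, -, hii⟩ := hG hmaps
  -- tilt bounds and the new late time `τ₁`
  choose L hL using fun i ↦ kerrChartedWith_tilt_bound _ _ _ _ _ _ _ (hK i)
  obtain ⟨T, hT⟩ := Finite.exists_le fun i ↦ (d.toOver.τ₀ + L i) / c i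
  obtain ⟨τ₁, hτ₀'τ₁, hTτ₁⟩ : ∃ τ₁ : ℝ, τ₀' < τ₁ ∧ T ≤ τ₁ :=
    ⟨max (τ₀' + 1) T, (lt_add_one _).trans_le (le_max_left _ _), le_max_right _ _⟩
  have hτ₀τ₁ : d.toOver.τ₀ ≤ τ₁ := hτ₀'.trans hτ₀'τ₁.le
  have htilt : ∀ i, ∀ u ∈ (Kerr.exterior (M i) (a i) : Set E4), τ₁ < u 0 → d.toOver.τ₀ < Θ i u 0 := by
    intro i u hu hu0
    have h1 := (abs_le.1 (hL i u hu)).1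
    have h2 : (d.toOver.τ₀ + L i) / c i ≤ τ₁ := (hT i).trans hTτ₁
    rw [div_le_iff₀ (hc i)] at h2
    nlinarith [mul_lt_mul_of_pos_left hu0 (hc i)]
  -- the hole charts: late charts into `O`, then into `O'`
  have himgO : ∀ i, recutChart d M a Θ hmaps i '' (recutBackground d M a i).lateRegion τ₁ ⊆ O := by
    rintro i _ ⟨y, hy, rfl⟩
    refine (d.toOver.isLateChart i).image_subset ⟨⟨_, hmaps i y.2⟩, ?_, rfl⟩
    show d.toOver.τ₀ < (poincareInv (d.motion i).1 (d.motion i).2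
      (((d.motion i).1 : E4 ≃L[ℝ] E4) (Θ i (poincareInv (d.motion i).1 (d.motion i).2 y.1)) + (d.motion i).2)) 0
    rw [poincareInv_apply_add]
    exact htilt i _ (mem_boostedKerrExterior.1 y.2) hy
  have hlateO : ∀ i, 𝒟.toSpacetime.IsLateChart (recutBackground d M a i) O τ₁ (recutChart d M a Θ hmaps i) :=
    fun i ↦ isLateChart_recut (d.adapted i) (d.motion i).1 (d.motion i).2 (d.toOver.isLateChart i)
      (hr₀ i).le (hΘs i) (hinj i) (hiso i) (hmaps i) (htilt i) (himgO i)
  have hlate : ∀ i, 𝒟.toSpacetime.IsLateChart (recutBackground d M a i)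
      (Summit.FinalStateConjecture.exteriorOf 𝒟.toCauchyDevelopment (recutCharted d M a Θ τ₁)) τ₁
      (recutChart d M a Θ hmaps i) := fun i ↦
    ⟨(hlateO i).contMDiff, (hlateO i).isOpenEmbedding,
      subset_exteriorOf_of_isOpen _ ((himgO i).trans hO.subset) (isOpen_image_of_isLateChart (hlateO i)) (by
        rw [recutCharted_eq d M a Θ hmaps]
        exact subset_union_of_subset_right
          (subset_iUnion (fun i ↦ recutChart d M a Θ hmaps i '' (recutBackground d M a i).lateRegion τ₁) i) _)⟩
  -- the flat chart, re-based at `τ₁`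
  have hflatimg : d.toOver.flatChart '' (Minkowski.backgroundOn d.toOver.flatDomain).lateRegion τ₁ ⊆ O :=
    (image_mono ((Minkowski.backgroundOn d.toOver.flatDomain).lateRegion_mono hτ₀τ₁)).trans
      d.toOver.isLateChart_flat.image_subset
  have hflatO : 𝒟.toSpacetime.IsLateChart (Minkowski.backgroundOn d.toOver.flatDomain) O τ₁ d.toOver.flatChart :=
    isLateChart_rebase _ d.toOver.isLateChart_flat hτ₀τ₁ (isOpen_lateRegion_backgroundOn _ _) hflatimg
  have hflat : 𝒟.toSpacetime.IsLateChart (Minkowski.backgroundOn d.toOver.flatDomain)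
      (Summit.FinalStateConjecture.exteriorOf 𝒟.toCauchyDevelopment (recutCharted d M a Θ τ₁)) τ₁
      d.toOver.flatChart :=
    ⟨hflatO.contMDiff, hflatO.isOpenEmbedding,
      subset_exteriorOf_of_isOpen _ (hflatimg.trans hO.subset) (isOpen_image_of_isLateChart hflatO)
        subset_union_left⟩
  -- near-zone convergence for every radius, separation, excision
  have hconv' : ∀ i (R : ℝ), Tendsto (fun τ ↦ 𝒟.toSpacetime.truncDeviationCk (recutBackground d M a i)
      (recutChart d M a Θ hmaps i) 2 R τ) atTop (𝓝 0) := fun i ↦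
    tendsto_truncDeviationCk_of_tendsto_atTop _ _ _ (hR' i) (hconv i)
  have hsep := separation_recut d M a c r₀ Θ hmaps hsub hc hr₀ (fun i ↦ (hΘs i).continuousOn) hΘm hΘe
  obtain ⟨ρ, hρ, hρdom⟩ := excision_transfer 𝒟.toSpacetime O 2 d a
  -- the covering clause at `τ₁` from (ii)
  have hanti := exteriorOf_mono 𝒟.toCauchyDevelopment (recutCharted_anti d M a Θ hτ₀'τ₁.le)
  have hcov : Summit.FinalStateConjecture.exteriorOf 𝒟.toCauchyDevelopment (recutCharted d M a Θ τ₁) \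
      ((⋃ i, recutChart d M a Θ hmaps i '' (recutBackground d M a i).lateRegion τ₁) ∪
        d.toOver.flatChart '' (Minkowski.backgroundOn d.toOver.flatDomain).lateRegion τ₁) ⊆
      𝒟.metric.causalPast 𝒟.timeOrientation
        ((⋃ i, recutChart d M a Θ hmaps i '' (recutBackground d M a i).timeSlab τ₁) ∪
          d.toOver.flatChart '' (Minkowski.backgroundOn d.toOver.flatDomain).timeSlab τ₁) := fun p hp ↦
    LorentzianMetric.causalFuture_mono (recutCertifiedSlab_subset d M a Θ hmaps R' τ₁)
      (hii τ₁ hτ₀'τ₁ ⟨hanti hp.1, fun h ↦ hp.2 (recutCertifiedLate_subset d M a Θ hmaps R' τ₁ h)⟩)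
  -- honest radii (re-typed `HasExhaustiveCharts`, 2026-08-16T21:18Z): raise the growing radii `R'` of the
  -- covering to at least `max (r₊, 0) + 1`; eventually `R'' = R'`, and the certified sets only grow
  set R'' : Fin d.N → ℝ → ℝ := fun i τ ↦ max (R' i τ) (max (Kerr.rPlus (M i) (a i)) 0 + 1) with hR''
  have hR'le : ∀ i τ, R' i τ ≤ R'' i τ := fun i τ ↦ le_max_left _ _
  have hconv'' : ∀ i, Tendsto (fun τ ↦ 𝒟.toSpacetime.truncDeviationCk (recutBackground d M a i)
      (recutChart d M a Θ hmaps i) 2 (R'' i τ) τ) atTop (𝓝 0) := by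
    intro i
    refine (hconv i).congr' ?_
    filter_upwards [(hR' i).eventually_ge_atTop (max (Kerr.rPlus (M i) (a i)) 0 + 1)] with τ hτ
    simp only [hR'', max_eq_left hτ]
    rfl
  have hlate_mono : ∀ τ₂, recutCertifiedLate d M a Θ R' τ₂ ⊆ recutCertifiedLate d M a Θ R'' τ₂ :=
    fun τ₂ ↦ union_subset_union le_rfl (iUnion_mono fun i ↦ recutImage_mono d Θ i
      (image_mono fun x hx ↦ ⟨hx.1, hx.2.trans (hR'le i _)⟩))
  have hslab_mono : ∀ τ₂, recutCertifiedSlab d M a Θ R' τ₂ ⊆ recutCertifiedSlab d M a Θ R'' τ₂ :=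
    fun τ₂ ↦ union_subset_union le_rfl (iUnion_mono fun i ↦ recutImage_mono d Θ i
      (image_mono ((recutBackground d M a i).truncTimeSlab_mono (hR'le i τ₂) τ₂)))
  refine ⟨_, recutDecomposition d M a Θ hmaps τ₁ (fun i ↦ (hsub i).pos) (fun i ↦ (hsub i).le) hlate hconv'
    hsep ρ hρ (hρdom τ₁ hτ₀τ₁) hflat hcov, hsub, ?_, R'', fun i ↦ ⟨?_, fun τ ↦ ?_⟩, hconv'',
    fun τ₂ hτ₂ ↦ ?_⟩
  · rw [charted_recutDecomposition]
  · exact tendsto_atTop_mono (hR'le i) (hR' i)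
  · exact le_max_right _ _
  · rw [certifiedLate_recutDecomposition, certifiedSlab_recutDecomposition]
    exact fun p hp ↦ LorentzianMetric.causalFuture_mono (hslab_mono τ₂)
      (hii τ₂ (hτ₀'τ₁.trans hτ₂) ⟨hanti hp.1, fun h ↦ hp.2 (hlate_mono τ₂ h)⟩)


end Summit.FinalStateConjecture.FinalStateConjecture.Theorems.SymplecticDualOfTheBomb

end
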